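import Mathlib.NumberTheory.LegendreSymbol.QuadraticChar.Basic
import Literature.NumberTheory.EllipticCurves.KramerTwoDescentSquares
import Literature.NumberTheory.EllipticCurves.KramerTwoDescentValuation
import Literature.NumberTheory.EllipticCurves.KramerTwoDescentLocal
import HarnessLib

/-!
# Local images of the complete `2`-descent over `ℚ` at an odd prime of multiplicative type

For the complete `2`-descent of an elliptic curve `y² = (x - e₁)(x - e₂)(x - e₃)` over `ℚ`
(Silverman, *The Arithmetic of Elliptic Curves*, Prop. X.1.4; tree `twoDescentMap`,
`TwoDescent.lean`) the image of `E(ℚ)` in `ℚ*/ℚ*² × ℚ*/ℚ*²` is confined by LOCAL conditions at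
the places of `S = {∞} ∪ {p ∣ 2Δ}`. At an odd prime `p ∉ S` the condition is the parity of
`v_p` (tree `even_padicValRat_sub`, `Curve24A1Descent.lean`). This file treats the next case, an
odd prime `p` dividing exactly one difference of the roots, to the first power:
`p ∤ (e₁ - e₂)(e₁ - e₃)`, `v_p(e₂ - e₃) = 1` (for `eᵢ ∈ ℤ`; multiplicative reduction at `p`), and
proves the two local conditions on rational points in closed form:

* `even_padicValRat_sub_of_mult` — `v_p(x - e₁)` is even;
* `qrBit_sub_of_mult` — the class of the `p`-unit part of `x - e₁` modulo squares of `𝔽_p*` is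
  trivial when `v_p(x - e₂)` is even and equals that of `e₂ - e₁` when `v_p(x - e₂)` is odd:
  `qrBit p (x - e₁) = parityBit p (x - e₂) · qrBit p (e₂ - e₁)` in `ℤ/2`.

These are the conditions "`(b₁, b₂)` lies in the image of `E(ℚ_p)/2E(ℚ_p)`" of Silverman,
*AEC* X.1 (proof of Prop. X.1.4, Example X.1.5; the local image at such `p` is
`{v_p(b₁) even, χ_p(b₁) = χ_p(e₂ - e₁)^{v_p(b₂)}}`, of order `4 = #E(ℚ_p)[2]`), proved here by the
elementary case analysis on `v_p(x - e₁)` (negative: all three factors dominate equally; positive: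
the other two factors are the units `e₁ - e₂ ≡ e₁ - e₃`; zero: either `x ≡ e₂ ≡ e₃`, where
`v_p(x - e₂)` is odd and `x - e₁ ≡ e₂ - e₁`, or all three factors are units with
`x - e₂ ≡ x - e₃`). Only statements about RATIONAL points are made (no `ℚ_p`).

Infrastructure (namespace `Literature.NumberTheory.EllipticCurves.TwoDescentLocal`): the
`p`-unit part `unitPart p a = a / p^{v_p(a)}` of a rational, its residue `res p a ∈ 𝔽_p`
(multiplicative, non-zero, ultrametric: `res (a + b) = res a` if `v_p(a) < v_p(b)`), the bit
`qrBit p a ∈ ℤ/2` (`1` iff the residue is a non-square; additive on products for odd `p`, via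
Mathlib's `quadraticChar`) and the induced character `qrHom p : Additive (ℚ*/ℚ*²) →+ ℤ/2`
(companion of the tree's `signHom`, `parityHom`, `KramerTwoDescentSquares.lean`).

## References

* J. H. Silverman, *The Arithmetic of Elliptic Curves*, 2nd ed., GTM 106 (2009), Prop. X.1.4,
  Example X.1.5, Thm. X.1.1(c). [SilvermanAEC2009]
-/

noncomputable section

open scoped Classical

open WeierstrassCurve.Affine

namespace Literature.NumberTheory.EllipticCurves.TwoDescentLocal

open Literature.NumberTheory.EllipticCurves.KramerTwoDescent

variable (p : ℕ) [hp : Fact p.Prime]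

/-! ### `p`-integrality of rationals -/

omit hp in
/-- If `p` divides the denominator of `a ≠ 0` then `v_p(a) < 0`. [folklore] -/
theorem padicValRat_neg_of_dvd_den [Fact p.Prime] {a : ℚ} (h : p ∣ a.den) :
    padicValRat p a < 0 := by
  have hcop : a.num.natAbs.Coprime a.den := a.reduced
  have hn : ¬ p ∣ a.num.natAbs := fun hn =>
    (Fact.out : p.Prime).ne_one (Nat.eq_one_of_dvd_coprimes hcop hn h)
  have hv : padicValRat p a = (padicValNat p a.num.natAbs : ℤ) - (padicValNat p a.den : ℤ) := by
    rw [padicValRat_def]; rfl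
  have : 1 ≤ padicValNat p a.den :=
    (padicValNat_dvd_iff_le a.den_pos.ne').mp (by rwa [pow_one])
  rw [hv, padicValNat.eq_zero_of_not_dvd hn]
  omega

/-- A rational with `v_p(a) ≥ 0` has denominator prime to `p` (in `𝔽_p`: `den a ≠ 0`).
[folklore] -/
theorem den_ne_zero_of_nonneg {a : ℚ} (h : 0 ≤ padicValRat p a) : (a.den : ZMod p) ≠ 0 := by
  rw [Ne, ZMod.natCast_eq_zero_iff]
  exact fun hd => absurd (padicValRat_neg_of_dvd_den p hd) (not_lt.mpr h)

/-- A rational with `v_p(a) = 0`, `a ≠ 0`, has numerator prime to `p` (in `𝔽_p`: `num a ≠ 0`).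
[folklore] -/
theorem num_ne_zero_of_eq_zero {a : ℚ} (ha : a ≠ 0) (h : padicValRat p a = 0) :
    (a.num : ZMod p) ≠ 0 := by
  rw [Ne, ZMod.intCast_zmod_eq_zero_iff_dvd]
  intro hn
  have hd : ¬ p ∣ a.den := not_dvd_den_of_padicValRat_eq_zero h
  have hv : padicValRat p a = (padicValInt p a.num : ℤ) - (padicValNat p a.den : ℤ) := rfl
  rw [hv, padicValNat.eq_zero_of_not_dvd hd] at h
  have hnum0 : a.num ≠ 0 := Rat.num_ne_zero.mpr ha
  have hdvd : p ∣ a.num.natAbs := Int.natCast_dvd.mp hn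
  have h1 : 1 ≤ padicValNat p a.num.natAbs :=
    (padicValNat_dvd_iff_le (Int.natAbs_ne_zero.mpr hnum0)).mp (by rwa [pow_one])
  have h2 : padicValInt p a.num = padicValNat p a.num.natAbs := rfl
  omega

/-- A rational with `v_p(a) > 0` maps to `0` in `𝔽_p`. [folklore] -/
theorem cast_eq_zero_of_pos {a : ℚ} (h : 0 < padicValRat p a) : (a : ZMod p) = 0 := by
  have hd : ¬ p ∣ a.den := fun hd => absurd (padicValRat_neg_of_dvd_den p hd) (by omega)
  have hv : padicValRat p a = (padicValInt p a.num : ℤ) - (padicValNat p a.den : ℤ) := rfl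
  rw [hv, padicValNat.eq_zero_of_not_dvd hd, Nat.cast_zero, sub_zero] at h
  have hn : (p : ℤ) ∣ a.num := by
    by_contra hn
    rw [padicValInt.eq_zero_of_not_dvd hn] at h
    exact lt_irrefl _ h
  rw [Rat.cast_def, (ZMod.intCast_zmod_eq_zero_iff_dvd _ _).mpr hn, zero_div]

/-! ### Unit parts and residues -/

/-- The `p`-unit part `a / p^{v_p(a)}` of a rational (`0` for `a = 0`). [folklore] -/
def unitPart (a : ℚ) : ℚ := a / (p : ℚ) ^ padicValRat p a

omit hp in
/-- `a = p^{v_p(a)} · unitPart p a`. [folklore] -/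
theorem zpow_mul_unitPart [Fact p.Prime] (a : ℚ) :
    (p : ℚ) ^ padicValRat p a * unitPart p a = a := by
  have hp0 : (p : ℚ) ≠ 0 := Nat.cast_ne_zero.mpr (Fact.out : p.Prime).ne_zero
  rw [unitPart, mul_div_cancel₀ _ (zpow_ne_zero _ hp0)]

/-- The unit part of `a ≠ 0` is a `p`-unit. [folklore] -/
theorem padicValRat_unitPart {a : ℚ} (ha : a ≠ 0) : padicValRat p (unitPart p a) = 0 := by
  have hp0 : (p : ℚ) ≠ 0 := Nat.cast_ne_zero.mpr hp.out.ne_zero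
  rw [unitPart, padicValRat.div ha (zpow_ne_zero _ hp0), padicValRat.zpow,
    padicValRat.self hp.out.one_lt, mul_one, sub_self]

/-- The unit part of `a ≠ 0` is non-zero. [folklore] -/
theorem unitPart_ne_zero {a : ℚ} (ha : a ≠ 0) : unitPart p a ≠ 0 := by
  have hp0 : (p : ℚ) ≠ 0 := Nat.cast_ne_zero.mpr hp.out.ne_zero
  exact div_ne_zero ha (zpow_ne_zero _ hp0)

/-- The unit part is multiplicative. [folklore] -/
theorem unitPart_mul {a b : ℚ} (ha : a ≠ 0) (hb : b ≠ 0) :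
    unitPart p (a * b) = unitPart p a * unitPart p b := by
  have hp0 : (p : ℚ) ≠ 0 := Nat.cast_ne_zero.mpr hp.out.ne_zero
  rw [unitPart, unitPart, unitPart, padicValRat.mul ha hb, zpow_add₀ hp0]
  field_simp

omit hp in
/-- The unit part of a `p`-unit is itself. [folklore] -/
theorem unitPart_of_eq_zero [Fact p.Prime] {a : ℚ} (h : padicValRat p a = 0) : unitPart p a = a := by
  rw [unitPart, h, zpow_zero, div_one]

/-- The residue in `𝔽_p` of the `p`-unit part of a rational (`0` for `a = 0`). [folklore] -/
def res (a : ℚ) : ZMod p := (unitPart p a : ZMod p)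

/-- The residue of a `p`-unit is its reduction. [folklore] -/
theorem res_of_eq_zero {a : ℚ} (h : padicValRat p a = 0) : res p a = (a : ZMod p) := by
  rw [res, unitPart_of_eq_zero p h]

/-- The residue of `a ≠ 0` is non-zero. [folklore] -/
theorem res_ne_zero {a : ℚ} (ha : a ≠ 0) : res p a ≠ 0 := by
  have h0 := padicValRat_unitPart p ha
  rw [res, Rat.cast_def]
  exact div_ne_zero (num_ne_zero_of_eq_zero p (unitPart_ne_zero p ha) h0)
    (den_ne_zero_of_nonneg p h0.ge)

/-- The residue is multiplicative (on non-zero rationals). [folklore] -/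
theorem res_mul {a b : ℚ} (ha : a ≠ 0) (hb : b ≠ 0) : res p (a * b) = res p a * res p b := by
  rw [res, res, res, unitPart_mul p ha hb,
    Rat.cast_mul_of_ne_zero (den_ne_zero_of_nonneg p (padicValRat_unitPart p ha).ge)
      (den_ne_zero_of_nonneg p (padicValRat_unitPart p hb).ge)]

/-- **Ultrametric residues**: if `v_p(a) < v_p(b)` (or `b = 0`) then `res (a + b) = res a`.
[folklore] -/
theorem res_add_of_lt {a b : ℚ} (ha : a ≠ 0) (h : b = 0 ∨ padicValRat p a < padicValRat p b) :
    res p (a + b) = res p a := by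
  rcases h with rfl | hlt
  · rw [add_zero]
  have hp0 : (p : ℚ) ≠ 0 := Nat.cast_ne_zero.mpr hp.out.ne_zero
  by_cases hb : b = 0
  · rw [hb, add_zero]
  obtain ⟨hab, hv⟩ := padicValRat_add_eq_left ha (Or.inr hlt)
  set k := padicValRat p a with hk
  have hua : padicValRat p (a / (p : ℚ) ^ k) = 0 := by
    rw [padicValRat.div ha (zpow_ne_zero _ hp0), padicValRat.zpow, padicValRat.self hp.out.one_lt]
    ring
  have hub : 0 < padicValRat p (b / (p : ℚ) ^ k) := by
    rw [padicValRat.div hb (zpow_ne_zero _ hp0), padicValRat.zpow, padicValRat.self hp.out.one_lt]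
    omega
  rw [res, res, unitPart, unitPart, hv, ← hk, add_div,
    Rat.cast_add_of_ne_zero (den_ne_zero_of_nonneg p hua.ge) (den_ne_zero_of_nonneg p hub.le),
    cast_eq_zero_of_pos p hub, add_zero]

/-! ### The quadratic-residue bit and the character `qrHom` -/

/-- `qrBit p a = 1` iff the residue of the unit part of `a` is a non-square in `𝔽_p`
(for `a = 0`: `0`). [folklore] -/
def qrBit (a : ℚ) : ZMod 2 := if quadraticChar (ZMod p) (res p a) = -1 then 1 else 0

/-- `qrBit` vanishes iff the residue is a square (for `a ≠ 0`). [folklore] -/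
theorem qrBit_eq_zero_iff (a : ℚ) : qrBit p a = 0 ↔ IsSquare (res p a) := by
  rw [qrBit]
  constructor
  · intro h
    by_contra hns
    rw [if_pos ((quadraticChar_neg_one_iff_not_isSquare).mpr hns)] at h
    exact one_ne_zero h
  · intro hsq
    rw [if_neg]
    rw [quadraticChar_neg_one_iff_not_isSquare, not_not]
    exact hsq

/-- **`qrBit` is additive on products** (for odd `p`): the Legendre symbol is multiplicative.
[folklore] -/
theorem qrBit_mul {a b : ℚ} (ha : a ≠ 0) (hb : b ≠ 0) :
    qrBit p (a * b) = qrBit p a + qrBit p b := by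
  have hra := res_ne_zero p ha
  have hrb := res_ne_zero p hb
  simp only [qrBit, res_mul p ha hb, map_mul]
  rcases quadraticChar_dichotomy hra with h1 | h1
  · rcases quadraticChar_dichotomy hrb with h2 | h2
    · simp [h1, h2]
    · simp [h1, h2]
  · rcases quadraticChar_dichotomy hrb with h2 | h2
    · simp [h1, h2]
    · simp only [h1, h2, mul_neg, mul_one, neg_neg, if_true]
      decide

/-- `qrBit` kills squares. [folklore] -/
theorem qrBit_mul_self (a : ℚ) : qrBit p (a * a) = 0 := by
  by_cases ha : a = 0
  · rw [ha, mul_zero, qrBit, if_neg]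
    rw [res, unitPart, zero_div, Rat.cast_zero, MulChar.map_zero]
    norm_num
  · rw [qrBit_eq_zero_iff p, res_mul p ha ha]
    exact ⟨res p a, rfl⟩

/-- `qrBit (a²) = 0`. [folklore] -/
theorem qrBit_sq (a : ℚ) : qrBit p (a ^ 2) = 0 := by rw [sq, qrBit_mul_self]

/-- `qrBit` only depends on the residue: equal residues give equal bits. [folklore] -/
theorem qrBit_congr {a b : ℚ} (h : res p a = res p b) : qrBit p a = qrBit p b := by
  rw [qrBit, qrBit, h]

/-- `qrBit` as a monoid homomorphism `ℚˣ → ℤ/2ℤ`. [folklore] -/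
def qrUnitsHom : ℚˣ →* Multiplicative (ZMod 2) where
  toFun u := Multiplicative.ofAdd (qrBit p (u : ℚ))
  map_one' := by
    rw [Units.val_one, show (1 : ℚ) = 1 * 1 from (mul_one 1).symm, qrBit_mul_self]; rfl
  map_mul' u v := by
    rw [Units.val_mul, qrBit_mul p u.ne_zero v.ne_zero, ofAdd_add]

/-- Squares lie in the kernel of `qrUnitsHom`. [folklore] -/
theorem range_powMonoidHom_le_ker_qrUnitsHom :
    (powMonoidHom 2 : ℚˣ →* ℚˣ).range ≤ (qrUnitsHom p).ker := by
  rintro _ ⟨u, rfl⟩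
  rw [MonoidHom.mem_ker]
  show Multiplicative.ofAdd (qrBit p ((u ^ 2 : ℚˣ) : ℚ)) = 1
  rw [Units.val_pow_eq_pow_val, qrBit_sq]
  rfl

/-- **The quadratic-residue character of `ℚ*/ℚ*²` at an odd prime `p`**: the class of `a` goes
to `1 ∈ ℤ/2` iff the `p`-unit part of `a` is a non-residue mod `p` (Silverman AEC X.1, the
character distinguishing `u` from `1` in `ℚ_p*/ℚ_p*² = {1, u, p, pu}`). [folklore] -/
def qrHom : Additive (SqUnits ℚ) →+ ZMod 2 :=
  MonoidHom.toAdditiveLeft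
    (QuotientGroup.lift _ (qrUnitsHom p) (range_powMonoidHom_le_ker_qrUnitsHom p))

/-- The value of `qrHom` on a square class. [folklore] -/
theorem qrHom_sqClass {a : ℚ} (ha : a ≠ 0) :
    qrHom p (Additive.ofMul (sqClass a)) = qrBit p a := by
  rw [sqClass_of_ne_zero ha, qrHom, MonoidHom.toAdditiveLeft]
  simp [qrUnitsHom]

/-! ### The local conditions at an odd prime dividing `e₂ - e₃` once -/

section Mult

variable {p}
variable {e₁ e₂ e₃ : ℤ} {x y : ℚ}

/-- On `y² = (x - e₁)(x - e₂)(x - e₃)` with `y ≠ 0` the three factors are non-zero. [folklore] -/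
theorem factors_ne_zero (hy : y ≠ 0) (h : y ^ 2 = (x - e₁) * (x - e₂) * (x - e₃)) :
    x - e₁ ≠ 0 ∧ x - e₂ ≠ 0 ∧ x - e₃ ≠ 0 := by
  have h₀ : (x - e₁) * (x - e₂) * (x - e₃) ≠ 0 := h ▸ pow_ne_zero 2 hy
  exact ⟨fun h0 => h₀ (by rw [h0, zero_mul, zero_mul]), fun h0 => h₀ (by rw [h0, mul_zero, zero_mul]),
    fun h0 => h₀ (by rw [h0, mul_zero])⟩

/-- The bits of the three factors sum to zero: `qrBit (x-e₁) + qrBit (x-e₂) + qrBit (x-e₃) = 0`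
(their product is the square `y²`). [folklore] -/
theorem qrBit_add_add_eq_zero (hy : y ≠ 0)
    (h : y ^ 2 = (x - e₁) * (x - e₂) * (x - e₃)) :
    qrBit p (x - e₁) + qrBit p (x - e₂) + qrBit p (x - e₃) = 0 := by
  obtain ⟨h1, h2, h3⟩ := factors_ne_zero hy h
  rw [← qrBit_mul p h1 h2, ← qrBit_mul p (mul_ne_zero h1 h2) h3, ← h, qrBit_sq]

/-- The valuations of the three factors sum to an even number. [folklore] -/
theorem even_sum_padicValRat (hy : y ≠ 0) (h : y ^ 2 = (x - e₁) * (x - e₂) * (x - e₃)) :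
    Even (padicValRat p (x - e₁) + padicValRat p (x - e₂) + padicValRat p (x - e₃)) := by
  obtain ⟨h1, h2, h3⟩ := factors_ne_zero hy h
  have key := congrArg (padicValRat p) h
  rw [padicValRat.pow, padicValRat.mul (mul_ne_zero h1 h2) h3, padicValRat.mul h1 h2] at key
  exact ⟨padicValRat p y, by omega⟩

/-- `x - eⱼ = (x - eᵢ) + (eᵢ - eⱼ)` in `ℚ`. [folklore] -/
theorem sub_eq_sub_add_sub (x : ℚ) (a b : ℤ) : x - b = (x - a) + ((a : ℚ) - b) := by ring

/-- In `ℤ/2`, `b + b + b = 0` forces `b = 0`, and `c + b + b = 0` forces `c = 0`. [folklore] -/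
theorem zmod_two_aux : (∀ b : ZMod 2, b + b + b = 0 → b = 0) ∧ (∀ c b : ZMod 2, c + b + b = 0 → c = 0) ∧
    (∀ b : ZMod 2, b ≠ 0 → b = 1) := by
  refine ⟨by decide, by decide, by decide⟩

/-- **The local conditions at an odd multiplicative prime.** Let `p` be an odd prime with
`p ∤ e₁ - e₂`, `p ∤ e₁ - e₃`, `v_p(e₂ - e₃) = 1` (`eᵢ ∈ ℤ`). For every rational point `(x, y)`,
`y ≠ 0`, of `y² = (x - e₁)(x - e₂)(x - e₃)`:
(I) `v_p(x - e₁)` is even; (II) `qrBit p (x - e₁) = parityBit p (x - e₂) · qrBit p (e₂ - e₁)`,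
i.e. the `p`-unit part of `x - e₁` is a square mod `p` when `v_p(x - e₂)` is even and lies in the
class of `e₂ - e₁` when `v_p(x - e₂)` is odd. This is the membership of `δ(P) = (x - e₁, x - e₂)`
in the image of `E(ℚ_p)/2E(ℚ_p)` (a group of order `4`) for a prime of multiplicative reduction
(Silverman AEC X.1, proof of Prop. X.1.4 / Example X.1.5), by the case analysis on
`v_p(x - e₁) <, =, > 0`. [cite: SilvermanAEC2009, Prop. X.1.4] -/
theorem local_conditions_of_mult (h₁₂ : ¬ (p : ℤ) ∣ e₁ - e₂)
    (h₁₃ : ¬ (p : ℤ) ∣ e₁ - e₃) (h₂₃ : padicValRat p ((e₂ : ℚ) - e₃) = 1)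
    (hy : y ≠ 0) (h : y ^ 2 = (x - e₁) * (x - e₂) * (x - e₃)) :
    Even (padicValRat p (x - e₁)) ∧
      qrBit p (x - e₁) = parityBit p (x - e₂) * qrBit p ((e₂ : ℚ) - e₁) := by
  obtain ⟨hx₁, hx₂, hx₃⟩ := factors_ne_zero hy h
  have hsum := even_sum_padicValRat (p := p) hy h
  have hbits := qrBit_add_add_eq_zero (p := p) hy h
  obtain ⟨aux3, auxc, aux1⟩ := zmod_two_aux
  -- the constants
  have hv₁₂ : padicValRat p ((e₁ : ℚ) - e₂) = 0 := by
    rw [← Int.cast_sub]; exact padicValRat_intCast_eq_zero h₁₂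
  have hv₁₃ : padicValRat p ((e₁ : ℚ) - e₃) = 0 := by
    rw [← Int.cast_sub]; exact padicValRat_intCast_eq_zero h₁₃
  have hv₂₁ : padicValRat p ((e₂ : ℚ) - e₁) = 0 := by
    rw [show (e₂ : ℚ) - e₁ = -((e₁ : ℚ) - e₂) by ring, padicValRat.neg, hv₁₂]
  have hv₃₂ : padicValRat p ((e₃ : ℚ) - e₂) = 1 := by
    rw [show (e₃ : ℚ) - e₂ = -((e₂ : ℚ) - e₃) by ring, padicValRat.neg, h₂₃]
  have he₁₂ : (e₁ : ℚ) - e₂ ≠ 0 := by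
    rw [← Int.cast_sub, Int.cast_ne_zero]; exact fun h0 => h₁₂ (h0 ▸ dvd_zero _)
  have he₁₃ : (e₁ : ℚ) - e₃ ≠ 0 := by
    rw [← Int.cast_sub, Int.cast_ne_zero]; exact fun h0 => h₁₃ (h0 ▸ dvd_zero _)
  have he₂₁ : (e₂ : ℚ) - e₁ ≠ 0 := by rw [show (e₂ : ℚ) - e₁ = -((e₁ : ℚ) - e₂) by ring]; exact neg_ne_zero.mpr he₁₂
  have he₂₃ : (e₂ : ℚ) - e₃ ≠ 0 := by
    intro h0; rw [h0, padicValRat.zero] at h₂₃; exact zero_ne_one h₂₃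
  have he₃₂ : (e₃ : ℚ) - e₂ ≠ 0 := by rw [show (e₃ : ℚ) - e₂ = -((e₂ : ℚ) - e₃) by ring]; exact neg_ne_zero.mpr he₂₃
  -- the relations between the factors
  have r₂ : x - e₂ = (x - e₁) + ((e₁ : ℚ) - e₂) := by ring
  have r₃ : x - e₃ = (x - e₁) + ((e₁ : ℚ) - e₃) := by ring
  have r₁' : x - e₁ = ((e₂ : ℚ) - e₁) + (x - e₂) := by ring
  have r₃' : x - e₃ = (x - e₂) + ((e₂ : ℚ) - e₃) := by ring
  have r₂' : x - e₂ = (x - e₃) + ((e₃ : ℚ) - e₂) := by ring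
  rcases lt_trichotomy (padicValRat p (x - e₁)) 0 with hneg | hzero | hpos
  · -- Case `v(x - e₁) < 0`: all three factors dominate equally
    have d₂ := padicValRat_add_eq_left (p := p) hx₁ (b := (e₁ : ℚ) - e₂) (Or.inr (by rw [hv₁₂]; exact hneg))
    have d₃ := padicValRat_add_eq_left (p := p) hx₁ (b := (e₁ : ℚ) - e₃) (Or.inr (by rw [hv₁₃]; exact hneg))
    rw [← r₂] at d₂
    rw [← r₃] at d₃
    have heven : Even (padicValRat p (x - e₁)) := by
      rw [d₂.2, d₃.2] at hsum
      obtain ⟨k, hk⟩ := hsum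
      exact ⟨k - padicValRat p (x - e₁), by omega⟩
    refine ⟨heven, ?_⟩
    have q₂ : qrBit p (x - e₂) = qrBit p (x - e₁) :=
      qrBit_congr p (by rw [r₂, res_add_of_lt p hx₁ (Or.inr (by rw [hv₁₂]; exact hneg))])
    have q₃ : qrBit p (x - e₃) = qrBit p (x - e₁) :=
      qrBit_congr p (by rw [r₃, res_add_of_lt p hx₁ (Or.inr (by rw [hv₁₃]; exact hneg))])
    rw [q₂, q₃] at hbits
    have hpar : parityBit p (x - e₂) = 0 := by rw [parityBit_eq_zero_iff, d₂.2]; exact heven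
    rw [aux3 _ hbits, hpar, zero_mul]
  · -- Case `v(x - e₁) = 0`
    refine ⟨⟨0, by rw [hzero]; rfl⟩, ?_⟩
    rcases lt_trichotomy (padicValRat p (x - e₂)) 0 with h2neg | h2zero | h2pos
    · -- `v(x - e₂) < 0` is impossible
      exfalso
      have d := padicValRat_add_eq_left (p := p) hx₂ (b := (e₂ : ℚ) - e₁) (Or.inr (by rw [hv₂₁]; exact h2neg))
      rw [add_comm, ← r₁'] at d
      rw [d.2] at hzero
      exact absurd hzero h2neg.ne
    · -- all three factors are units, `x - e₃ ≡ x - e₂`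
      have hv₃ : padicValRat p (x - e₃) = 0 := by
        rcases lt_trichotomy (padicValRat p (x - e₃)) 0 with h3 | h3 | h3
        · exfalso
          have d := padicValRat_add_eq_left (p := p) hx₃ (b := (e₃ : ℚ) - e₂) (Or.inr (by rw [hv₃₂]; omega))
          rw [← r₂'] at d
          rw [d.2] at h2zero
          exact absurd h2zero h3.ne
        · exact h3
        · exfalso
          have d := le_padicValRat_add_or (p := p) (a := x - e₃) (b := (e₃ : ℚ) - e₂) (c := 1)
            (Or.inr (by omega)) (Or.inr (by rw [hv₃₂]))
          rw [← r₂'] at d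
          rcases d with d | d
          · exact hx₂ d
          · rw [h2zero] at d; exact absurd d (by norm_num)
      have q₃ : qrBit p (x - e₃) = qrBit p (x - e₂) :=
        qrBit_congr p (by rw [r₃', res_add_of_lt p hx₂ (Or.inr (by rw [h2zero, h₂₃]; norm_num))])
      rw [q₃] at hbits
      have hpar : parityBit p (x - e₂) = 0 := by rw [parityBit_eq_zero_iff, h2zero]; exact ⟨0, rfl⟩
      rw [auxc _ _ hbits, hpar, zero_mul]
    · -- `x ≡ e₂ ≡ e₃`: `x - e₁ ≡ e₂ - e₁`, and `v(x - e₂)` is odd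
      have q₁ : qrBit p (x - e₁) = qrBit p ((e₂ : ℚ) - e₁) :=
        qrBit_congr p (by rw [r₁', res_add_of_lt p he₂₁ (Or.inr (by rw [hv₂₁]; exact h2pos))])
      have hodd : ¬ Even (padicValRat p (x - e₂)) := by
        intro hev
        rcases (show padicValRat p (x - e₂) = 1 ∨ 1 < padicValRat p (x - e₂) by omega) with h21 | h21
        · rw [h21] at hev; exact Int.not_even_one hev
        · -- `v(x - e₃) = 1`, so `0 + v₂ + 1` is even
          have d := padicValRat_add_eq_left (p := p) he₂₃ (b := x - e₂) (Or.inr (by rw [h₂₃]; exact h21))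
          rw [add_comm, ← r₃'] at d
          rw [hzero, d.2, h₂₃] at hsum
          obtain ⟨k, hk⟩ := hev
          obtain ⟨m, hm⟩ := hsum
          omega
      have hpar : parityBit p (x - e₂) = 1 :=
        aux1 _ (fun h0 => hodd (parityBit_eq_zero_iff.mp h0))
      rw [q₁, hpar, one_mul]
  · -- Case `v(x - e₁) > 0`: the other two factors are the units `e₁ - e₂ ≡ e₁ - e₃`
    have d₂ := padicValRat_add_eq_left (p := p) he₁₂ (b := x - e₁) (Or.inr (by rw [hv₁₂]; exact hpos))
    have d₃ := padicValRat_add_eq_left (p := p) he₁₃ (b := x - e₁) (Or.inr (by rw [hv₁₃]; exact hpos))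
    rw [add_comm, ← r₂] at d₂
    rw [add_comm, ← r₃] at d₃
    have heven : Even (padicValRat p (x - e₁)) := by
      rw [d₂.2, d₃.2, hv₁₂, hv₁₃, add_zero, add_zero] at hsum
      exact hsum
    refine ⟨heven, ?_⟩
    have q₂ : qrBit p (x - e₂) = qrBit p ((e₁ : ℚ) - e₂) :=
      qrBit_congr p (by rw [r₂, add_comm, res_add_of_lt p he₁₂ (Or.inr (by rw [hv₁₂]; exact hpos))])
    have q₃ : qrBit p (x - e₃) = qrBit p ((e₁ : ℚ) - e₃) :=
      qrBit_congr p (by rw [r₃, add_comm, res_add_of_lt p he₁₃ (Or.inr (by rw [hv₁₃]; exact hpos))])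
    have q₂₃ : qrBit p ((e₁ : ℚ) - e₃) = qrBit p ((e₁ : ℚ) - e₂) :=
      qrBit_congr p (by
        rw [show (e₁ : ℚ) - e₃ = ((e₁ : ℚ) - e₂) + ((e₂ : ℚ) - e₃) by ring,
          res_add_of_lt p he₁₂ (Or.inr (by rw [hv₁₂, h₂₃]; norm_num))])
    rw [q₂, q₃, q₂₃] at hbits
    have hpar : parityBit p (x - e₂) = 0 := by
      rw [parityBit_eq_zero_iff, d₂.2, hv₁₂]; exact ⟨0, rfl⟩
    rw [auxc _ _ hbits, hpar, zero_mul]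

/-- **Local condition I**, stated alone: `v_p(x - e₁)` is even.
[cite: SilvermanAEC2009, Prop. X.1.4] -/
theorem even_padicValRat_sub_of_mult (h₁₂ : ¬ (p : ℤ) ∣ e₁ - e₂)
    (h₁₃ : ¬ (p : ℤ) ∣ e₁ - e₃) (h₂₃ : padicValRat p ((e₂ : ℚ) - e₃) = 1)
    (hy : y ≠ 0) (h : y ^ 2 = (x - e₁) * (x - e₂) * (x - e₃)) :
    Even (padicValRat p (x - e₁)) :=
  (local_conditions_of_mult h₁₂ h₁₃ h₂₃ hy h).1

/-- **Local condition II**, stated alone: `qrBit p (x - e₁) = parityBit p (x - e₂) · qrBit p (e₂ - e₁)`.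
[cite: SilvermanAEC2009, Prop. X.1.4] -/
theorem qrBit_sub_of_mult (h₁₂ : ¬ (p : ℤ) ∣ e₁ - e₂)
    (h₁₃ : ¬ (p : ℤ) ∣ e₁ - e₃) (h₂₃ : padicValRat p ((e₂ : ℚ) - e₃) = 1)
    (hy : y ≠ 0) (h : y ^ 2 = (x - e₁) * (x - e₂) * (x - e₃)) :
    qrBit p (x - e₁) = parityBit p (x - e₂) * qrBit p ((e₂ : ℚ) - e₁) :=
  (local_conditions_of_mult h₁₂ h₁₃ h₂₃ hy h).2

end Mult

end Literature.NumberTheory.EllipticCurves.TwoDescentLocal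

end
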